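import Literature.Computability.AlgebraicComplexity.InterfaceMatMulTerms
import HarnessLib

/-!
# Counting the level-1 blocks of an interface tensor: multiplicativity over the terms and the
entropy estimate (Vassilevska Williams–Xu–Xu–Zhou 2024, §3.9 Lemma 3.3 as used in §5–§6) — proved

Topic `Literature/Computability/AlgebraicComplexity`.  Every count of the analysis of Vassilevska
Williams–Xu–Xu–Zhou, *New bounds for matrix multiplication: from alpha to omega* (SODA 2024,
arXiv:2307.07970) is a product, over the terms (or position classes) of an interface tensor, of
numbers of words of a prescribed type, each estimated by Lemma 3.3
(`binom(N; α(1)N, …, α(s)N) = 2^{N(H(α) ± o(1))}`): e.g. the proof of Thm. 6.1 ("the number of level-1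
`X`-blocks in `T^{⊗n_t}` that conform with `ξ` is `2^{n_t H(ξ) ± o(n)}`"), §6.6 ("the number of
`X_Î ∈ X_I` satisfying ALL constraints … is `∏_{t} 2^{n_t Σ α (H(γ̃)+H(γ̃)) − o(n)}`"), and the proof of
Claim 5.14 ("we can count the number of valid subsequences of `K̂` for each of these subsets of
indices, and multiply them together").  This file PROVES the two ingredients for the level-1 blocks
`levelBlocksX τ L ε` of an interface tensor (`InterfaceTensors.lean`):

* `card_levelBlocksX_eq_prod` — **multiplicativity**: `|levelBlocksX τ L ε| = ∏_t |termBlocksX n_t (L t) ε|`,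
  `n_t = |τ⁻¹(t)|`, the blocks of the one-term tensors (`InterfaceMatMulTerms.lean`); through the
  fibrewise decomposition `(Fin n → A) ≃ Π_t (τ⁻¹(t) → A)` (`fibrewiseEquiv`) and the observation
  that admissibility is a conjunction of conditions on the restrictions to the terms
  (`mem_levelBlocksX_iff_forall_restrict`);
* `card_levelBlocksX_zero_eq_prod_multinomial` — with `card_termBlocksX_zero`: at `ε = 0`, for types
  `γ_X^{(t)} = k_t/n_t` supported on shapes of level `i_t`,
  **`|levelBlocksX τ L 0| = ∏_t binom(n_t; k_t)`**, and the entropy sandwich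
  `2^{∑_t n_t H(k_t/n_t)} ≤ (∏_t (n_t+1)^{3^c}) · |levelBlocksX τ L 0|`,
  `|levelBlocksX τ L 0| ≤ 2^{∑_t n_t H(k_t/n_t)}` (`MultinomialEntropy.lean`), i.e. the printed
  `2^{∑_t n_t H(γ_X^{(t)}) ± o(n)}`.

(The same statements for `Y` and `Z` are the instances with `(j, γ_Y)`, `(k, γ_Z)`; they are stated
for the generic one-dimensional data `admissibleSeqs τ deg γ ε` as `card_admissibleSeqs_eq_prod`.)
Everything is proved; no named facts.

## References

* V. Vassilevska Williams, Y. Xu, Z. Xu, R. Zhou, *New bounds for matrix multiplication: from alpha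
  to omega*, SODA 2024, arXiv:2307.07970 (held: `paper:arxiv-2307.07970`): §3.9 Lemma 3.3, Thm. 6.1
  (proof), §6.6, Claim 5.14 (proof). [VassilevskaWilliamsXuXuZhou2024]
-/

noncomputable section

open scoped BigOperators
open Finset

namespace Literature.Computability.AlgebraicComplexity

universe u

/-! ## The fibrewise decomposition of sequences along a term map -/

section Fibrewise

variable {n s : ℕ} {A : Type*}

/-- **`(Fin n → A) ≃ Π_t (τ⁻¹(t) → A)`**: a sequence on the concatenated chunk set is the family of
its restrictions to the terms. [folklore] -/
def fibrewiseEquiv (τ : Fin n → Fin s) : (Fin n → A) ≃ ((t : Fin s) → {u // τ u = t} → A) where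
  toFun f t u := f u.1
  invFun g u := g (τ u) ⟨u, rfl⟩
  left_inv f := rfl
  right_inv g := by
    funext t u
    rcases u with ⟨u, rfl⟩
    rfl

/-- Entries of the fibrewise decomposition. [folklore] -/
@[simp] theorem fibrewiseEquiv_apply (τ : Fin n → Fin s) (f : Fin n → A) (t : Fin s) (u : {u // τ u = t}) :
    fibrewiseEquiv τ f t u = f u.1 := rfl

/-- The chunk set `τ⁻¹(t)` of the term `t`. [cite: VassilevskaWilliamsXuXuZhou2024, Def. 4.1 (the n_t chunks of term t)] -/
abbrev termFibre (τ : Fin n → Fin s) (t : Fin s) : Finset (Fin n) := univ.filter fun u => τ u = t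

/-- `|{u // τ u = t}| = n_t`. [folklore] -/
theorem card_subtype_termFibre (τ : Fin n → Fin s) (t : Fin s) :
    Fintype.card {u // τ u = t} = (termFibre τ t).card :=
  Fintype.card_subtype _

/-- An enumeration `τ⁻¹(t) ≃ Fin n_t` of the chunks of a term. [folklore] -/
def termEnum (τ : Fin n → Fin s) (t : Fin s) : {u // τ u = t} ≃ Fin (termFibre τ t).card :=
  Fintype.equivFinOfCardEq (card_subtype_termFibre τ t)

/-- **The restriction of a sequence to the term `t`, re-indexed by `Fin n_t`.** [cite: VassilevskaWilliamsXuXuZhou2024, Def. 4.1] -/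
def restrictTerm (τ : Fin n → Fin s) (t : Fin s) (I : Fin n → A) : Fin (termFibre τ t).card → A :=
  fun m => I ((termEnum τ t).symm m).1

/-- Entries of the restriction. [folklore] -/
@[simp] theorem restrictTerm_apply (τ : Fin n → Fin s) (t : Fin s) (I : Fin n → A) (m : Fin (termFibre τ t).card) :
    restrictTerm τ t I m = I ((termEnum τ t).symm m).1 := rfl

/-- Counting through the enumeration: `#{m | I_{u(m)} = a} = #{u ∈ τ⁻¹(t) | I_u = a}`. [folklore] -/
theorem card_filter_restrictTerm [DecidableEq A] (τ : Fin n → Fin s) (t : Fin s) (I : Fin n → A) (a : A) :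
    (univ.filter fun m => restrictTerm τ t I m = a).card = ((termFibre τ t).filter fun u => I u = a).card := by
  refine card_bij (fun m _ => ((termEnum τ t).symm m).1) (fun m hm => ?_) (fun m₁ _ m₂ _ h => ?_)
    (fun u hu => ?_)
  · rw [mem_filter] at hm ⊢
    exact ⟨by simpa using ((termEnum τ t).symm m).2, hm.2⟩
  · exact (termEnum τ t).symm.injective (Subtype.ext h)
  · rw [mem_filter] at hu
    refine ⟨termEnum τ t ⟨u, by simpa using hu.1⟩, ?_, by simp⟩
    rw [mem_filter]
    exact ⟨mem_univ _, by simpa using hu.2⟩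

end Fibrewise

/-! ## Admissibility is a conjunction of conditions on the restrictions to the terms -/

section Restrict

variable {c n s : ℕ}

/-- The complete split distribution of the restriction to a term is `split(Î, τ⁻¹(t))`.
[cite: VassilevskaWilliamsXuXuZhou2024, Def. 3.5 and Def. 4.1] -/
theorem completeSplitOn_restrictTerm_univ (τ : Fin n → Fin s) (t : Fin s) (I : Fin n → Fin c → Fin 3) :
    completeSplitOn (restrictTerm τ t I) univ = completeSplitOn I (termFibre τ t) := by
  funext σ
  rw [completeSplitOn_apply, completeSplitOn_apply, card_filter_restrictTerm, card_univ, Fintype.card_fin]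

/-- **Membership in the blocks of a one-term tensor** (`termBlocksX m T ε`): the level condition on
every chunk, and — for `m ≥ 1` — `ε`-consistency of the complete split distribution over all chunks.
[cite: VassilevskaWilliamsXuXuZhou2024, Def. 3.6] -/
theorem mem_termBlocksX_iff {m : ℕ} (T : InterfaceTerm c) (ε : ℝ) (g : Fin m → Fin c → Fin 3) :
    g ∈ termBlocksX m T ε ↔ (∀ v, patternLevel (g v) = T.i) ∧ (0 < m → SplitConsistentOn ε T.γX g univ) := by
  rw [termBlocksX, levelBlocksX, mem_admissibleSeqs]
  refine and_congr Iff.rfl ?_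
  have huniv : ∀ t : Fin 1, (univ.filter fun u : Fin m => (fun _ : Fin m => (0 : Fin 1)) u = t) = univ := by
    intro t; ext u; simp [Subsingleton.elim (0 : Fin 1) t]
  constructor
  · intro h hm
    have := h 0 (by rw [huniv]; exact univ_nonempty_iff.2 ⟨⟨0, hm⟩⟩)
    rwa [huniv] at this
  · intro h t ht
    rw [huniv] at ht ⊢
    obtain ⟨v, _⟩ := ht
    exact h (Fin.pos v)

/-- The generic one-dimensional version of `mem_termBlocksX_iff`. [cite: VassilevskaWilliamsXuXuZhou2024, Def. 3.6] -/
theorem mem_admissibleSeqs_const_iff {m : ℕ} (d : ℕ) (γ : (Fin c → Fin 3) → ℝ) (ε : ℝ)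
    (g : Fin m → Fin c → Fin 3) :
    g ∈ admissibleSeqs (fun _ : Fin m => (0 : Fin 1)) (fun _ => d) (fun _ => γ) ε ↔
      (∀ v, patternLevel (g v) = d) ∧ (0 < m → SplitConsistentOn ε γ g univ) := by
  have := mem_termBlocksX_iff (m := m) ⟨d, 0, 0, γ, γ, γ⟩ ε g
  exact this

/-- **Admissibility of a sequence = admissibility of its restriction to every term** (as a block of
the corresponding one-term tensor). [cite: VassilevskaWilliamsXuXuZhou2024, Def. 4.1 (𝒯 = ⊗_t terms)] -/
theorem mem_admissibleSeqs_iff_forall_restrict (τ : Fin n → Fin s) (deg : Fin s → ℕ)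
    (γ : Fin s → (Fin c → Fin 3) → ℝ) (ε : ℝ) (I : Fin n → Fin c → Fin 3) :
    I ∈ admissibleSeqs τ deg γ ε ↔
      ∀ t, restrictTerm τ t I ∈ admissibleSeqs (fun _ : Fin (termFibre τ t).card => (0 : Fin 1))
        (fun _ => deg t) (fun _ => γ t) ε := by
  conv_rhs => simp only [mem_admissibleSeqs_const_iff]
  rw [mem_admissibleSeqs]
  constructor
  · rintro ⟨hlev, hsplit⟩ t
    refine ⟨fun v => ?_, fun hm => ?_⟩
    · rw [restrictTerm_apply]
      have hu := ((termEnum τ t).symm v).2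
      rw [hlev, hu]
    · have hne : (termFibre τ t).Nonempty := by
        rw [← Finset.card_pos]; exact hm
      rw [SplitConsistentOn, completeSplitOn_restrictTerm_univ]
      exact hsplit t hne
  · intro h
    refine ⟨fun u => ?_, fun t hne => ?_⟩
    · have := (h (τ u)).1 (termEnum τ (τ u) ⟨u, rfl⟩)
      simpa [restrictTerm_apply] using this
    · have hm : 0 < (termFibre τ t).card := Finset.card_pos.2 hne
      have := (h t).2 hm
      rwa [SplitConsistentOn, completeSplitOn_restrictTerm_univ] at this

/-- The `X`-instance: the level-1 `X`-blocks of `𝒯` are the sequences all of whose restrictions are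
blocks of the one-term tensors `T_{i_t,j_t,k_t}^{⊗n_t}[γ_X^{(t)}, γ_Y^{(t)}, γ_Z^{(t)}, ε]`.
[cite: VassilevskaWilliamsXuXuZhou2024, Def. 4.1] -/
theorem mem_levelBlocksX_iff_forall_restrict (τ : Fin n → Fin s) (L : Fin s → InterfaceTerm c) (ε : ℝ)
    (I : Fin n → Fin c → Fin 3) :
    I ∈ levelBlocksX τ L ε ↔ ∀ t, restrictTerm τ t I ∈ termBlocksX (termFibre τ t).card (L t) ε :=
  mem_admissibleSeqs_iff_forall_restrict τ _ _ ε I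

end Restrict

/-! ## Multiplicativity of the block count over the terms -/

section Product

variable {c n s : ℕ}

/-- **The admissible sequences are in bijection with the families of admissible restrictions.**
[cite: VassilevskaWilliamsXuXuZhou2024, Def. 4.1] -/
def admissibleSeqsEquiv (τ : Fin n → Fin s) (deg : Fin s → ℕ) (γ : Fin s → (Fin c → Fin 3) → ℝ) (ε : ℝ) :
    ↥(admissibleSeqs τ deg γ ε) ≃
      ((t : Fin s) → ↥(admissibleSeqs (fun _ : Fin (termFibre τ t).card => (0 : Fin 1))
        (fun _ => deg t) (fun _ => γ t) ε)) :=
  -- through the fibrewise decomposition and, on each fibre, the enumeration `termEnum`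
  let Q : (t : Fin s) → ({u // τ u = t} → Fin c → Fin 3) → Prop := fun t h =>
    (fun m => h ((termEnum τ t).symm m)) ∈
      admissibleSeqs (fun _ : Fin (termFibre τ t).card => (0 : Fin 1)) (fun _ => deg t) (fun _ => γ t) ε
  have hQ : ∀ I : Fin n → Fin c → Fin 3, I ∈ admissibleSeqs τ deg γ ε ↔ ∀ t, Q t (fibrewiseEquiv τ I t) :=
    fun I => mem_admissibleSeqs_iff_forall_restrict τ deg γ ε I
  ((fibrewiseEquiv τ).subtypeEquiv hQ).trans <|
    (Equiv.subtypePiEquivPi (p := Q)).trans <|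
      Equiv.piCongrRight fun t =>
        (Equiv.arrowCongr (termEnum τ t) (Equiv.refl (Fin c → Fin 3))).subtypeEquiv fun _ => Iff.rfl

/-- **Multiplicativity of the block count over the terms**: the number of admissible sequences is the
product over the terms of the numbers of blocks of the one-term tensors,
`|admissibleSeqs τ deg γ ε| = ∏_t |admissibleSeqs (one term, n_t chunks) ε|`.
[cite: VassilevskaWilliamsXuXuZhou2024, §6.6 ("the number of X_Î ∈ X_I satisfying ALL constraints … is ∏_{t}") and Claim 5.14 (proof: "count … for each of these subsets of indices, and multiply them together")] -/
theorem card_admissibleSeqs_eq_prod (τ : Fin n → Fin s) (deg : Fin s → ℕ) (γ : Fin s → (Fin c → Fin 3) → ℝ)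
    (ε : ℝ) :
    (admissibleSeqs τ deg γ ε).card =
      ∏ t, (admissibleSeqs (fun _ : Fin (termFibre τ t).card => (0 : Fin 1)) (fun _ => deg t) (fun _ => γ t) ε).card := by
  rw [← Fintype.card_coe, Fintype.card_congr (admissibleSeqsEquiv τ deg γ ε), Fintype.card_pi]
  exact prod_congr rfl fun t _ => Fintype.card_coe _

/-- **`|levelBlocksX τ L ε| = ∏_t |termBlocksX n_t (L t) ε|`.** [cite: VassilevskaWilliamsXuXuZhou2024, §6.6 and Claim 5.14 (proof)] -/
theorem card_levelBlocksX_eq_prod (τ : Fin n → Fin s) (L : Fin s → InterfaceTerm c) (ε : ℝ) :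
    (levelBlocksX τ L ε).card = ∏ t, (termBlocksX (termFibre τ t).card (L t) ε).card :=
  card_admissibleSeqs_eq_prod τ _ _ ε

end Product

/-! ## The count at `ε = 0`: a product of multinomial coefficients, and its entropy estimate -/

section Entropy

variable {c n s : ℕ}

/-- **`|levelBlocksX τ L 0| = ∏_t binom(n_t; k_t)`** for types `γ_X^{(t)} = k_t/n_t` (integral, summing
to `n_t`) supported on chunk shapes of level `i_t` (the first input constraint of §6).  Terms without
chunks contribute the factor `binom(0; 0) = 1`. [cite: VassilevskaWilliamsXuXuZhou2024, Thm. 6.1 (proof) and §6.6] -/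
theorem card_levelBlocksX_zero_eq_prod_multinomial (τ : Fin n → Fin s) (L : Fin s → InterfaceTerm c)
    (k : Fin s → (Fin c → Fin 3) → ℕ) (hk : ∀ t σ, (k t σ : ℝ) = (termFibre τ t).card * (L t).γX σ)
    (hsupp : ∀ t σ, k t σ ≠ 0 → patternLevel σ = (L t).i) (hsum : ∀ t, ∑ σ, k t σ = (termFibre τ t).card) :
    (levelBlocksX τ L 0).card = ∏ t, Nat.multinomial univ (k t) := by
  rw [card_levelBlocksX_eq_prod]
  refine prod_congr rfl fun t _ => ?_
  rcases Nat.eq_zero_or_pos (termFibre τ t).card with h0 | hpos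
  · -- no chunks: one (empty) block, and `k t = 0`
    have hk0 : k t = 0 := by
      funext σ
      have := hsum t
      rw [h0] at this
      exact (sum_eq_zero_iff.1 this) σ (mem_univ σ)
    rw [hk0]
    have h1 : (termBlocksX (termFibre τ t).card (L t) 0).card = 1 := by
      rw [h0]
      have : termBlocksX 0 (L t) 0 = univ := by
        ext g
        simp only [mem_termBlocksX_iff, mem_univ, iff_true]
        exact ⟨fun v => v.elim0, fun h => absurd h (lt_irrefl 0)⟩
      rw [this, card_univ, Fintype.card_fun, Fintype.card_fin, pow_zero]
    rw [h1]
    simp [Nat.multinomial]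
  · exact card_termBlocksX_zero hpos (L t) (k t) (hk t) (hsupp t) (hsum t)

/-- **The entropy estimate (Lemma 3.3), upper half**: `|levelBlocksX τ L 0| ≤ 2^{∑_t n_t H(k_t/n_t)}`.
[cite: VassilevskaWilliamsXuXuZhou2024, Lemma 3.3 and Thm. 6.1 (proof: "2^{n_t H(ξ) ± o(n)}")] -/
theorem card_levelBlocksX_zero_le_two_rpow (τ : Fin n → Fin s) (L : Fin s → InterfaceTerm c)
    (k : Fin s → (Fin c → Fin 3) → ℕ) (hk : ∀ t σ, (k t σ : ℝ) = (termFibre τ t).card * (L t).γX σ)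
    (hsupp : ∀ t σ, k t σ ≠ 0 → patternLevel σ = (L t).i) (hsum : ∀ t, ∑ σ, k t σ = (termFibre τ t).card) :
    ((levelBlocksX τ L 0).card : ℝ) ≤
      2 ^ (∑ t, ((termFibre τ t).card : ℝ) *
        shannonEntropy (fun σ => (k t σ : ℝ) / (termFibre τ t).card)) := by
  rw [card_levelBlocksX_zero_eq_prod_multinomial τ L k hk hsupp hsum, Real.rpow_sum_of_pos two_pos]
  push_cast
  refine prod_le_prod (fun t _ => by positivity) fun t _ => ?_
  exact multinomial_le_two_rpow_mul_shannonEntropy (k t) (hsum t)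

/-- **The entropy estimate (Lemma 3.3), lower half**:
`2^{∑_t n_t H(k_t/n_t)} ≤ (∏_t (n_t+1)^{3^c}) · |levelBlocksX τ L 0|` — the polynomial loss
`∏ (n_t+1)^{|{0,1,2}^c|} = 2^{o(n)}`. [cite: VassilevskaWilliamsXuXuZhou2024, Lemma 3.3 and Thm. 6.1 (proof)] -/
theorem two_rpow_le_mul_card_levelBlocksX_zero (τ : Fin n → Fin s) (L : Fin s → InterfaceTerm c)
    (k : Fin s → (Fin c → Fin 3) → ℕ) (hk : ∀ t σ, (k t σ : ℝ) = (termFibre τ t).card * (L t).γX σ)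
    (hsupp : ∀ t σ, k t σ ≠ 0 → patternLevel σ = (L t).i) (hsum : ∀ t, ∑ σ, k t σ = (termFibre τ t).card) :
    (2 : ℝ) ^ (∑ t, ((termFibre τ t).card : ℝ) * shannonEntropy (fun σ => (k t σ : ℝ) / (termFibre τ t).card)) ≤
      (∏ t, (((termFibre τ t).card + 1 : ℝ)) ^ (3 ^ c)) * (levelBlocksX τ L 0).card := by
  rw [card_levelBlocksX_zero_eq_prod_multinomial τ L k hk hsupp hsum, Real.rpow_sum_of_pos two_pos]
  push_cast
  rw [← prod_mul_distrib]
  refine prod_le_prod (fun t _ => by positivity) fun t _ => ?_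
  have h := two_rpow_mul_shannonEntropy_le_mul_multinomial (k t) (hsum t)
  have hcard : (Fintype.card (Fin c → Fin 3) : ℝ) = 3 ^ c := by
    rw [Fintype.card_fun, Fintype.card_fin, Fintype.card_fin]; push_cast; ring
  simpa [hcard] using h

end Entropy

end Literature.Computability.AlgebraicComplexity
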